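/-
Origin: expansion seat `planner-pub-hodgecm-toy-0`, handover #2 2026-08-18T04:13:45Z (`HOME/pub-hodgecm-toy/lean/Toy/Weil.lean`, md5 07fa89b3, 485 lines);
landed by the gen-5 packager in gate run 21 as `HodgeCM/Model/Toy/Weil.lean` (import ^import Toy\.→import HodgeCM.Model.Toy. ×2).
-/
-- HANDOVER (planner-pub-hodgecm-toy-0, unit pub-hodgecm-toy): WIP module `Toy.Weil`; intended final module
-- `HodgeCM.Model.Toy.Weil` (kind L5, toy model / consistency witness); rename `import Toy.X` ↦ the final prefix.
/-
Copyright (c) 2026. All rights reserved.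
Released under Apache 2.0 license as described in the file LICENSE.
-/
import Summits.HodgeConjecture.HodgeCM.Model.Toy.CMFacts
import Summits.HodgeConjecture.HodgeCM.Model.Toy.EigenBasis_2
import Summits.HodgeConjecture.HodgeCM.CM.Lemmas

/-!
# The Weil line of the exterior model: `Fact_weilLine_hodge` (M16) and `Fact_weilLine_rank` (M15)

* **M16** (`fact_weilLine_hodge`, any Hodge data `D`): every Weil generator
  `pr₀^*y₀ ∪ pr₁^*y₁ ∪ pr₂^*y₂ ∪ pr₃^*y₃` with the `yᵢ` in one eigencharacter `σ` lies in
  `F^{#{i : σ ∈ Φᵢ}} H⁴(P) = F² H⁴(P)` — the exponent is `2` by the corner identity `SumTwo`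
  (`HodgeCM.sumTwo_corner`), and the membership is `HodgeData.mul` + `HodgeData.natural` + `deg1`.
* **M15** (`fact_weilLine_rank`): `dim_ℚ W_K(P) = [K:ℚ]` — see the second part of this file.
-/

noncomputable section

namespace HodgeCM.Toy

open Literature.AlgebraicGeometry.Motives
open Literature.AlgebraicGeometry.Motives.HodgeStructure (EndAction conj ofRat ofRat_apply complexConj
  mem_hodgeClasses_iff)
open scoped TensorProduct
open exteriorPower CMPresentation Module

variable (D : HodgeData)

/-! ## M16: Weil classes are Hodge classes -/

section M16

variable (K : CMField) (Φ : Fin 4 → CMType K)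

/-- `prᵢ^* yᵢ ∈ F^{ind Φᵢ σ} H¹(P)` for `yᵢ` a `σ`-eigenform on the `i`-th corner. -/
lemma pullC_pr4_mem_F (σ : K →+* ℂ) (i : Fin 4)
    (y : (toyModelWith D).CohC ((toyModelWith D).cmAV K (Φ i)) 1)
    (hy : y ∈ (toyModelWith D).eigenLine K (Φ i) σ) :
    (toyModelWith D).pullC ((toyModelWith D).pr4 K Φ i) 1 y
      ∈ (D.hs ((toyModelWith D).prod4 K Φ) 1).F (ind (Φ i) σ) := by
  unfold ind
  split_ifs with hσ
  · have hy1 : y ∈ (D.hs (cmObj K (Φ i)) 1).F 1 := by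
      rw [hsF_one]
      rw [eigenLine_eq, Submodule.mem_span_singleton] at hy
      obtain ⟨c, rfl⟩ := hy
      exact Submodule.smul_mem _ c (gen_mem_F1C K (Φ i) hσ)
    exact D.natural ((toyModelWith D).pr4 K Φ i) 1 1 ⟨y, hy1, rfl⟩
  · rw [D.deg1]
    simp [Obj.F1filt]

/-- every Weil generator lies in `F² H⁴(P)` -/
lemma weilGenerators_le_F2 :
    Submodule.span ℂ ((toyModelWith D).weilGenerators K Φ) ≤ (D.hs ((toyModelWith D).prod4 K Φ) 4).F 2 ↔
      ∀ x ∈ (toyModelWith D).weilGenerators K Φ, x ∈ (D.hs ((toyModelWith D).prod4 K Φ) 4).F 2 :=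
  Submodule.span_le

/-- (Ported verbatim from the HodgeCMPerL package; no docstring in the source.) -/
theorem span_weilGenerators_le_F (hΦ : SumTwo Φ) :
    Submodule.span ℂ ((toyModelWith D).weilGenerators K Φ) ≤ (D.hs ((toyModelWith D).prod4 K Φ) 4).F 2 := by
  rw [weilGenerators_le_F2]
  rintro _ ⟨σ, y, hy, rfl⟩
  have h01 := D.mul _ 1 _ _ _ _ (pullC_pr4_mem_F D K Φ σ 0 (y 0) (hy 0)) (pullC_pr4_mem_F D K Φ σ 1 (y 1) (hy 1))
  have h23 := D.mul _ 1 _ _ _ _ (pullC_pr4_mem_F D K Φ σ 2 (y 2) (hy 2)) (pullC_pr4_mem_F D K Φ σ 3 (y 3) (hy 3))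
  have h := D.mul _ 2 _ _ _ _ h01 h23
  have hsum : ind (Φ 0) σ + ind (Φ 1) σ + (ind (Φ 2) σ + ind (Φ 3) σ) = 2 := by
    have := hΦ σ; omega
  rw [hsum] at h
  exact h

/-- **M16 for the exterior model** (any Hodge data). -/
theorem fact_weilLine_hodge : (toyModelWith D).Fact_weilLine_hodge := by
  intro K f x hx
  change x ∈ (D.hs ((toyModelWith D).prod4 K f.corner) (2 * 2)).hodgeClasses ((2 : ℕ) : ℤ)
  rw [mem_hodgeClasses_iff]
  exact span_weilGenerators_le_F D K f.corner (sumTwo_corner f) hx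

end M16

/-! ## M15: the Weil line has rank `[K:ℚ]`

Write `P = A₀ × A₁ × A₂ × A₃` and `g_σ := pr₀^*gen_σ ∪ pr₁^*gen_σ ∪ pr₂^*gen_σ ∪ pr₃^*gen_σ` (`σ : K →+* ℂ`).
* `Θ₄ g_σ` is the eigen-monomial `e_{r_σ}` on the four slots with character `σ` (`theta_g`), hence `±` a
  wedge-basis vector, and distinct `σ` give distinct basis vectors: the `g_σ` are `ℂ`-linearly independent
  and span `W ⊗ ℂ`; so `dim_ℂ (W ⊗ ℂ) = n := [K:ℚ]` and `dim_ℚ W ≤ n` (`ofRat` of a `ℚ`-basis of `W` stays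
  `ℂ`-independent, by flatness of `ℂ/ℚ`).
* Conversely the **trace-form descent** `δ : K → H⁴(P, ℚ)`,
  `δ(λ) = Σ_{m} Tr(λ·d_{m₀}d_{m₁}d_{m₂}d_{m₃}) · v⁰_{m₀} ∪ v¹_{m₁} ∪ v²_{m₂} ∪ v³_{m₃}` satisfies
  `δ(λ) ⊗ 1 = Σ_σ σ(λ) g_σ` (`ofRat_delta`), so it is injective with image in `W`: `n ≤ dim_ℚ W`.
-/

namespace Obj

variable (X : Obj)

/-- the degree-one class `(oneEquiv⁻¹)_ℂ x ∈ ℂ ⊗ ⋀¹ L X` of a vector `x ∈ L X ⊗ ℂ` -/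
def form1 (x : X.LC) : ℂ ⊗[ℚ] ↥(⋀[ℚ]^1 X.L) := (oneEquiv ℚ X.L).symm.toLinearMap.baseChange ℂ x

/-- (Ported verbatim from the HodgeCMPerL package; no docstring in the source.) -/
lemma theta_form1 (x : X.LC) : X.Θ 1 (X.form1 x) = ιMulti ℂ 1 (fun _ => x) := by
  rw [form1, BC.thetaEquiv_apply, BC.theta_one_baseChange_oneEquiv_symm]
  simp [oneEquiv_symm_apply]

/-- (Ported verbatim from the HodgeCMPerL package; no docstring in the source.) -/
lemma map_one_oneEquiv_symm {X Y : Obj} (φ : Y.L →ₗ[ℚ] X.L) (y : Y.L) :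
    map 1 φ ((oneEquiv ℚ Y.L).symm y) = (oneEquiv ℚ X.L).symm (φ y) := by
  apply (oneEquiv ℚ X.L).injective
  have h := LinearMap.congr_fun (oneEquiv_naturality φ) ((oneEquiv ℚ Y.L).symm y)
  simp only [LinearMap.coe_comp, Function.comp_apply, LinearEquiv.coe_coe,
    LinearEquiv.apply_symm_apply] at h
  rw [h, LinearEquiv.apply_symm_apply]

/-- (Ported verbatim from the HodgeCMPerL package; no docstring in the source.) -/
lemma baseChange_map_one_form1 {X Y : Obj} (φ : Y.L →ₗ[ℚ] X.L) (y : Y.LC) :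
    (map 1 φ).baseChange ℂ (Y.form1 y) = X.form1 (φ.baseChange ℂ y) := by
  induction y using TensorProduct.induction_on with
  | zero => simp [form1]
  | tmul c v =>
      simp only [form1, LinearMap.baseChange_tmul, LinearEquiv.coe_coe, map_one_oneEquiv_symm]
  | add x y hx hy => simp only [form1, map_add] at hx hy ⊢; rw [hx, hy]

/-- (Ported verbatim from the HodgeCMPerL package; no docstring in the source.) -/
lemma theta_cup2_one (x y : ℂ ⊗[ℚ] ↥(⋀[ℚ]^1 X.L)) :
    X.Θ 2 (LinearMap.BilinMap.baseChange ℂ (wedge ℚ X.L 1 1) x y) = wedge ℂ X.LC 1 1 (X.Θ 1 x) (X.Θ 1 y) := by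
  apply Subtype.ext
  rw [wedge_coe]
  exact BC.theta_wedge ℚ ℂ X.L 1 x y

/-- (Ported verbatim from the HodgeCMPerL package; no docstring in the source.) -/
lemma theta_cup2_two (x y : ℂ ⊗[ℚ] ↥(⋀[ℚ]^2 X.L)) :
    X.Θ 4 (LinearMap.BilinMap.baseChange ℂ (wedge ℚ X.L 2 2) x y) = wedge ℂ X.LC 2 2 (X.Θ 2 x) (X.Θ 2 y) := by
  apply Subtype.ext
  rw [wedge_coe]
  exact BC.theta_wedge ℚ ℂ X.L 2 x y

/-- `Θ₄ ((a ∪ b) ∪ (c ∪ d)) = a ∧ b ∧ c ∧ d` for degree-one forms. -/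
lemma theta_quad (a b c d : X.LC) :
    X.Θ 4 (LinearMap.BilinMap.baseChange ℂ (wedge ℚ X.L 2 2)
        (LinearMap.BilinMap.baseChange ℂ (wedge ℚ X.L 1 1) (X.form1 a) (X.form1 b))
        (LinearMap.BilinMap.baseChange ℂ (wedge ℚ X.L 1 1) (X.form1 c) (X.form1 d)))
      = ιMulti ℂ 4 ![a, b, c, d] := by
  simp only [theta_cup2_two, theta_cup2_one, theta_form1]
  apply Subtype.ext
  simp only [wedge_coe, ιMulti_apply_coe, ExteriorAlgebra.ιMulti_apply]
  simp [List.ofFn_succ, mul_assoc]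

end Obj

section M15

variable (K : CMField) (Φ : Fin 4 → CMType K)

/-- the product of the four corners, as an object (`= (toyModelWith D).prod4 K Φ` by `rfl`) -/
def PP : Obj := Obj.prod (Obj.prod (Obj.prod (cmObj K (Φ 0)) (cmObj K (Φ 1))) (cmObj K (Φ 2))) (cmObj K (Φ 3))

/-- (Ported verbatim from the HodgeCMPerL package; no docstring in the source.) -/
lemma prod4_eq : (toyModelWith D).prod4 K Φ = PP K Φ := rfl

/-- the four slots of `L P = L A₀ × L A₁ × L A₂ × L A₃` -/
def slot : Fin 4 → (PP K Φ).s.toType :=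
  ![Sum.inl (Sum.inl (Sum.inl ())), Sum.inl (Sum.inl (Sum.inr ())), Sum.inl (Sum.inr ()), Sum.inr ()]

/-- (Ported verbatim from the HodgeCMPerL package; no docstring in the source.) -/
lemma slot_injective : Function.Injective (slot K Φ) := by
  intro i j h
  fin_cases i <;> fin_cases j <;> first | rfl | cases h

/-- the index map of `g_σ`: slot `i`, character `σ` -/
def r (σ : K →+* ℂ) : Fin 4 → (PP K Φ).Idx :=
  ![⟨Sum.inl (Sum.inl (Sum.inl ())), embOf K σ⟩, ⟨Sum.inl (Sum.inl (Sum.inr ())), embOf K σ⟩,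
    ⟨Sum.inl (Sum.inr ()), embOf K σ⟩, ⟨Sum.inr (), embOf K σ⟩]

/-- (Ported verbatim from the HodgeCMPerL package; no docstring in the source.) -/
lemma r_fst (σ : K →+* ℂ) (j : Fin 4) : (r K Φ σ j).1 = slot K Φ j := by
  fin_cases j <;> rfl

/-- (Ported verbatim from the HodgeCMPerL package; no docstring in the source.) -/
lemma r_injective (σ : K →+* ℂ) : Function.Injective (r K Φ σ) := by
  intro i j h
  have h1 := congrArg Sigma.fst h
  rw [r_fst, r_fst] at h1
  exact slot_injective K Φ h1

/-- (Ported verbatim from the HodgeCMPerL package; no docstring in the source.) -/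
lemma r_zero (σ : K →+* ℂ) : r K Φ σ 0 = ⟨Sum.inl (Sum.inl (Sum.inl ())), embOf K σ⟩ := rfl

open scoped Classical in
/-- (Ported verbatim from the HodgeCMPerL package; no docstring in the source.) -/
lemma sigma_eq_of_image_r_eq {σ σ' : K →+* ℂ}
    (h : Finset.univ.image (r K Φ σ) = Finset.univ.image (r K Φ σ')) : σ = σ' := by
  classical
  have hmem : r K Φ σ 0 ∈ Finset.univ.image (r K Φ σ') := by
    rw [← h]; exact Finset.mem_image_of_mem _ (Finset.mem_univ 0)
  obtain ⟨j, -, hj⟩ := Finset.mem_image.mp hmem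
  have h1 := congrArg Sigma.fst hj
  rw [r_fst, r_fst] at h1
  have hj0 : j = 0 := slot_injective K Φ h1
  subst hj0
  rw [r_zero, r_zero, Sigma.mk.inj_iff] at hj
  have h2 : embOf K σ' = embOf K σ := eq_of_heq hj.2
  exact ((embEquiv K).symm.injective h2).symm

/-- the Weil generator attached to `σ`: `g_σ = pr₀^*gen_σ ∪ pr₁^*gen_σ ∪ pr₂^*gen_σ ∪ pr₃^*gen_σ` -/
def g (σ : K →+* ℂ) : (toyModelWith D).CohC ((toyModelWith D).prod4 K Φ) 4 :=
  (toyModelWith D).quadC _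
    ((toyModelWith D).pullC ((toyModelWith D).pr4 K Φ 0) 1 (gen K (Φ 0) σ))
    ((toyModelWith D).pullC ((toyModelWith D).pr4 K Φ 1) 1 (gen K (Φ 1) σ))
    ((toyModelWith D).pullC ((toyModelWith D).pr4 K Φ 2) 1 (gen K (Φ 2) σ))
    ((toyModelWith D).pullC ((toyModelWith D).pr4 K Φ 3) 1 (gen K (Φ 3) σ))

/-- (Ported verbatim from the HodgeCMPerL package; no docstring in the source.) -/
lemma g_mem_weilGenerators (σ : K →+* ℂ) : g D K Φ σ ∈ (toyModelWith D).weilGenerators K Φ :=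
  ⟨σ, fun i => gen K (Φ i) σ, fun i => gen_mem_eigenLine D K (Φ i) σ, rfl⟩

/-- (Ported verbatim from the HodgeCMPerL package; no docstring in the source.) -/
lemma gen_eq_form1 (Ψ : CMType K) (σ : K →+* ℂ) :
    gen K Ψ σ = (cmObj K Ψ).form1 ((cmObj K Ψ).eT () (embOf K σ)) := by
  rw [gen, T_symm_eps]; rfl

/-- (Ported verbatim from the HodgeCMPerL package; no docstring in the source.) -/
lemma pullC_form1 {X Y : Obj} (f : Obj.Hom X Y) (y : Y.LC) :
    (toyModelWith D).pullC f 1 (Y.form1 y) = X.form1 (f.lin.baseChange ℂ y) :=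
  Obj.baseChange_map_one_form1 f.lin y

/-- (Ported verbatim from the HodgeCMPerL package; no docstring in the source.) -/
lemma pr4_eT_0 (τ : FK K →+* ℂ) :
    ((toyModelWith D).pr4 K Φ 0).lin.baseChange ℂ ((cmObj K (Φ 0)).eT () τ)
      = (PP K Φ).eT (Sum.inl (Sum.inl (Sum.inl ()))) τ := by
  show ((Obj.fst _ _).comp ((Obj.fst _ _).comp (Obj.fst _ _))).lin.baseChange ℂ _ = _
  simp only [Obj.Hom.comp, Obj.fst, LinearMap.baseChange_comp, LinearMap.comp_apply,
    Obj.baseChange_inlL_eT]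
  rfl

/-- (Ported verbatim from the HodgeCMPerL package; no docstring in the source.) -/
lemma pr4_eT_1 (τ : FK K →+* ℂ) :
    ((toyModelWith D).pr4 K Φ 1).lin.baseChange ℂ ((cmObj K (Φ 1)).eT () τ)
      = (PP K Φ).eT (Sum.inl (Sum.inl (Sum.inr ()))) τ := by
  show ((Obj.fst _ _).comp ((Obj.fst _ _).comp (Obj.snd _ _))).lin.baseChange ℂ _ = _
  simp only [Obj.Hom.comp, Obj.fst, Obj.snd, LinearMap.baseChange_comp, LinearMap.comp_apply,
    Obj.baseChange_inlL_eT, Obj.baseChange_inrL_eT]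
  rfl

/-- (Ported verbatim from the HodgeCMPerL package; no docstring in the source.) -/
lemma pr4_eT_2 (τ : FK K →+* ℂ) :
    ((toyModelWith D).pr4 K Φ 2).lin.baseChange ℂ ((cmObj K (Φ 2)).eT () τ)
      = (PP K Φ).eT (Sum.inl (Sum.inr ())) τ := by
  show ((Obj.fst _ _).comp (Obj.snd _ _)).lin.baseChange ℂ _ = _
  simp only [Obj.Hom.comp, Obj.fst, Obj.snd, LinearMap.baseChange_comp, LinearMap.comp_apply,
    Obj.baseChange_inlL_eT, Obj.baseChange_inrL_eT]
  rfl

/-- (Ported verbatim from the HodgeCMPerL package; no docstring in the source.) -/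
lemma pr4_eT_3 (τ : FK K →+* ℂ) :
    ((toyModelWith D).pr4 K Φ 3).lin.baseChange ℂ ((cmObj K (Φ 3)).eT () τ)
      = (PP K Φ).eT (Sum.inr ()) τ := by
  show (Obj.snd _ _).lin.baseChange ℂ _ = _
  simp only [Obj.snd, Obj.baseChange_inrL_eT]
  rfl

/-- (Ported verbatim from the HodgeCMPerL package; no docstring in the source.) -/
lemma g_eq (σ : K →+* ℂ) : g D K Φ σ
    = LinearMap.BilinMap.baseChange ℂ (wedge ℚ (PP K Φ).L 2 2)
        (LinearMap.BilinMap.baseChange ℂ (wedge ℚ (PP K Φ).L 1 1)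
          ((PP K Φ).form1 ((PP K Φ).eT (Sum.inl (Sum.inl (Sum.inl ()))) (embOf K σ)))
          ((PP K Φ).form1 ((PP K Φ).eT (Sum.inl (Sum.inl (Sum.inr ()))) (embOf K σ))))
        (LinearMap.BilinMap.baseChange ℂ (wedge ℚ (PP K Φ).L 1 1)
          ((PP K Φ).form1 ((PP K Φ).eT (Sum.inl (Sum.inr ())) (embOf K σ)))
          ((PP K Φ).form1 ((PP K Φ).eT (Sum.inr ()) (embOf K σ)))) := by
  have h0 : (toyModelWith D).pullC ((toyModelWith D).pr4 K Φ 0) 1 (gen K (Φ 0) σ)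
      = (PP K Φ).form1 ((PP K Φ).eT (Sum.inl (Sum.inl (Sum.inl ()))) (embOf K σ)) := by
    rw [gen_eq_form1, pullC_form1, pr4_eT_0]
    rfl
  have h1 : (toyModelWith D).pullC ((toyModelWith D).pr4 K Φ 1) 1 (gen K (Φ 1) σ)
      = (PP K Φ).form1 ((PP K Φ).eT (Sum.inl (Sum.inl (Sum.inr ()))) (embOf K σ)) := by
    rw [gen_eq_form1, pullC_form1, pr4_eT_1]
    rfl
  have h2 : (toyModelWith D).pullC ((toyModelWith D).pr4 K Φ 2) 1 (gen K (Φ 2) σ)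
      = (PP K Φ).form1 ((PP K Φ).eT (Sum.inl (Sum.inr ())) (embOf K σ)) := by
    rw [gen_eq_form1, pullC_form1, pr4_eT_2]
    rfl
  have h3 : (toyModelWith D).pullC ((toyModelWith D).pr4 K Φ 3) 1 (gen K (Φ 3) σ)
      = (PP K Φ).form1 ((PP K Φ).eT (Sum.inr ()) (embOf K σ)) := by
    rw [gen_eq_form1, pullC_form1, pr4_eT_3]
    rfl
  simp only [g, h0, h1, h2, h3]
  rfl

/-- **`Θ₄ g_σ = e_{r_σ}`**: the Weil generator is an eigen-monomial. -/
theorem theta_g (σ : K →+* ℂ) : (PP K Φ).Θ 4 (g D K Φ σ) = (PP K Φ).mono 4 (r K Φ σ) := by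
  simp only [g_eq, Obj.theta_quad]
  rw [Obj.mono]
  congr 1
  funext j
  fin_cases j
  · exact ((PP K Φ).eB_apply _ _).symm
  · exact ((PP K Φ).eB_apply _ _).symm
  · exact ((PP K Φ).eB_apply _ _).symm
  · exact ((PP K Φ).eB_apply _ _).symm

/-! ### Linear independence of the `g_σ` -/

/-- (Ported verbatim from the HodgeCMPerL package; no docstring in the source.) -/
lemma linearIndependent_mono_r :
    LinearIndependent ℂ (fun σ : K →+* ℂ => (PP K Φ).mono 4 (r K Φ σ)) := by
  classical
  choose perm hperm using fun σ : K →+* ℂ => (PP K Φ).mono_eq_sign_smul_basis (r K Φ σ) (r_injective K Φ σ)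
  have hS : Function.Injective (fun σ : K →+* ℂ => (PP K Φ).imFin (r K Φ σ) (r_injective K Φ σ)) := by
    intro σ σ' h
    have h' := congrArg Subtype.val h
    simp only [Obj.imFin_val] at h'
    exact sigma_eq_of_image_r_eq K Φ (by convert h' using 2)
  have hB := ((PP K Φ).eB.exteriorPower 4).linearIndependent.comp _ hS
  rw [Fintype.linearIndependent_iff] at hB ⊢
  intro c hc σ
  have hc' : ∑ τ, (c τ * ((Equiv.Perm.sign (perm τ) : ℤ) : ℂ)) •
      ((PP K Φ).eB.exteriorPower 4) ((PP K Φ).imFin (r K Φ τ) (r_injective K Φ τ)) = 0 := by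
    rw [← hc]
    refine Finset.sum_congr rfl fun τ _ => ?_
    rw [hperm τ, Units.smul_def, ← Int.cast_smul_eq_zsmul ℂ, smul_smul]
  have h := hB _ hc' σ
  rcases mul_eq_zero.mp h with h | h
  · exact h
  · exact absurd h (Int.cast_ne_zero.mpr (Units.ne_zero _))

/-- **The Weil generators `g_σ` are `ℂ`-linearly independent.** -/
theorem linearIndependent_g : LinearIndependent ℂ (g D K Φ) := by
  have h : LinearIndependent ℂ (fun σ => (PP K Φ).Θ 4 (g D K Φ σ)) := by
    simp_rw [theta_g]
    exact linearIndependent_mono_r K Φ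
  exact LinearIndependent.of_comp ((PP K Φ).Θ 4).toLinearMap h

/-! ### Upper bound: `dim_ℚ W ≤ n` -/

/-- (Ported verbatim from the HodgeCMPerL package; no docstring in the source.) -/
lemma weilGenerators_subset_span_g :
    (toyModelWith D).weilGenerators K Φ ⊆ ↑(Submodule.span ℂ (Set.range (g D K Φ))) := by
  rintro _ ⟨σ, y, hy, rfl⟩
  have hy' : ∀ i, ∃ c : ℂ, c • gen K (Φ i) σ = y i := fun i => by
    have h := hy i
    rw [eigenLine_eq, Submodule.mem_span_singleton] at h
    exact h
  choose c hc using hy'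
  have hy'' : y = fun i => c i • gen K (Φ i) σ := funext fun i => (hc i).symm
  subst hy''
  simp only [Universe.quadC, map_smul, LinearMap.smul_apply, smul_smul, SetLike.mem_coe]
  exact Submodule.smul_mem _ _ (Submodule.subset_span ⟨σ, rfl⟩)

/-- (Ported verbatim from the HodgeCMPerL package; no docstring in the source.) -/
lemma finrank_span_weilGenerators_le :
    finrank ℂ (Submodule.span ℂ ((toyModelWith D).weilGenerators K Φ)) ≤ Fintype.card (K →+* ℂ) :=
  (Submodule.finrank_mono (Submodule.span_le.mpr (weilGenerators_subset_span_g D K Φ))).trans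
    (finrank_range_le_card _)

/-- `ofRat` of a `ℚ`-basis of a subspace stays `ℂ`-linearly independent (flatness of `ℂ/ℚ`). -/
lemma linearIndependent_ofRat {V : Type*} [AddCommGroup V] [Module ℚ V] (W : Submodule ℚ V)
    {ι : Type*} (b : Module.Basis ι ℚ W) :
    LinearIndependent ℂ (fun j => (ofRat ((b j : W) : V) : ℂ ⊗[ℚ] V)) := by
  have h1 : LinearIndependent ℂ (⇑(Algebra.TensorProduct.basis ℂ b)) :=
    (Algebra.TensorProduct.basis ℂ b).linearIndependent
  have hker : LinearMap.ker (W.subtype.baseChange ℂ) = ⊥ := by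
    rw [LinearMap.ker_eq_bot]
    change Function.Injective (W.subtype.baseChange ℂ : ℂ ⊗[ℚ] W → ℂ ⊗[ℚ] V)
    rw [LinearMap.baseChange_eq_ltensor]
    exact Module.Flat.lTensor_preserves_injective_linearMap _ W.injective_subtype
  have h2 := h1.map' (W.subtype.baseChange ℂ) hker
  have e : ⇑(W.subtype.baseChange ℂ) ∘ ⇑(Algebra.TensorProduct.basis ℂ b)
      = fun j => (ofRat ((b j : W) : V) : ℂ ⊗[ℚ] V) := by
    funext j
    simp [Algebra.TensorProduct.basis_apply, LinearMap.baseChange_tmul]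
  rw [e] at h2
  exact h2

/-- (Ported verbatim from the HodgeCMPerL package; no docstring in the source.) -/
theorem finrank_weilLine_le :
    finrank ℚ ((toyModelWith D).weilLine K Φ) ≤ Fintype.card (K →+* ℂ) := by
  set W := (toyModelWith D).weilLine K Φ
  set S := Submodule.span ℂ ((toyModelWith D).weilGenerators K Φ)
  let bW := Module.finBasis ℚ W
  let f : Fin (finrank ℚ W) → S := fun j => ⟨ofRat ((bW j : W) : _), (bW j).2⟩
  have hf : LinearIndependent ℂ f := by
    apply LinearIndependent.of_comp S.subtype
    exact linearIndependent_ofRat W bW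
  have h := hf.fintype_card_le_finrank
  simp only [Fintype.card_fin] at h
  exact h.trans (finrank_span_weilGenerators_le D K Φ)


-- port_pkg: scope closed for this part
end M15
end HodgeCM.Toy
end
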